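import Summits.Ventures.PercRepro.RankLevelSetHallTightUp

/-!
# PercRepro — C-044, UP FORM AT THE TIGHT LAYER, FROM A FREE RESERVOIR: (♠′) ON EVERY FINITE MATROID WITH `p − q − 1` ELEMENTS
OUTSIDE THE CLOSURES OF ℛ (night-1, gen 15; dossier §26.3)

The injection (♠′) of RankLevelSetHallTightUp (`SpadeInjection`: ℛ = the rank-`q` supersets of members of size `q+1 … p−1`
injects into `𝒞 = bigMid` = the `Y`-sets of size `≥ p`, each above its preimage) is explicit on the model family
`T_p(U_{q,F} ⊕ U_{E∖F,E∖F})` (RankLevelSetRuleQModelHall): every set of ℛ lies in the flat `F`, and adjoining a fixed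
`(p − #S)`-subset of `E ∖ F` repairs it.  THIS FILE isolates what that argument uses, on an ARBITRARY finite matroid at the tight
layer `#E = p + q`: a **reservoir** `G = {e ∈ E : e ∉ cl S for every S ∈ ℛ}` of at least `p − q − 1` elements.  Then
`φ(S) = S ∪ W(p − #S)`, `W(j)` one fixed `j`-subset of `G`, is (♠′): a second set `S′ ∈ ℛ` inside `φ(S)` cannot meet `W`
(an element of `S′` lies in `cl S′`), so `S′ ⊆ S` and symmetrically; `φ(S)` has `p` elements and rank
`q + r_{M/cl S}(W) ∈ [q+1, p−1]`.  With `hallUp_of_ncard_eq_of_spade` this is the UP-Hall condition of C-044, and with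
`hallDown_of_ncard_eq` both forms.  The model is the case `G ⊇ E ∖ F`; the case `ℛ = ∅` (no rank-`q` set with more than `q`
elements contains a member — e.g. every rank-`q` flat through a member has exactly `q` points) is `G = E`.

* `spadeReservoir` — the reservoir `{e ∈ E | ∀ S ∈ ℛ, r(insert e S) ≠ q}`;
* `notMem_spadeReservoir_of_mem` — a set of ℛ is disjoint from the reservoir;
* **`spadeInjection_of_reservoir`** — `#E = p + q`, `p − q − 1 ≤ #G` ⇒ (♠′);
* **`hallUp_of_ncard_eq_of_reservoir`** — the UP-Hall condition of C-044 for every family of members under that hypothesis;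
* `hallUp_of_ncard_eq_of_rankqOver_empty` — the case `ℛ = ∅`.
Axioms: standard.
-/

namespace PercRepro

open Set Matroid

variable {α : Type} (M : Matroid α) [M.Finite]

/-- The **reservoir** of the cell `(p, q)`: the elements of `E` lying in the closure of no set of ℛ (`r(insert e S) ≠ q` for
every `S ∈ rankqOver M p q`). -/
def spadeReservoir (M : Matroid α) (p q : ℕ) : Set α :=
  {e ∈ M.E | ∀ S ∈ rankqOver M p q, M.eRk (insert e S) ≠ (q : ℕ∞)}

omit [M.Finite] in
/-- A set of ℛ is disjoint from the reservoir (an element of `S` has `insert e S = S`, of rank `q`). -/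
theorem notMem_spadeReservoir_of_mem {p q : ℕ} {S : Set α} (hS : S ∈ rankqOver M p q) {e : α} (he : e ∈ S) :
    e ∉ spadeReservoir M p q := by
  intro hG
  apply hG.2 S hS
  rw [Set.insert_eq_of_mem he]
  exact hS.2.1

omit [M.Finite] in
/-- An element of the reservoir raises the rank of every set of ℛ: `q < r(insert e S)`. -/
theorem lt_eRk_insert_of_mem_spadeReservoir {p q : ℕ} {S : Set α} (hS : S ∈ rankqOver M p q) {e : α}
    (he : e ∈ spadeReservoir M p q) : (q : ℕ∞) < M.eRk (insert e S) := by
  have h1 : (q : ℕ∞) ≤ M.eRk (insert e S) := by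
    rw [← hS.2.1]
    exact M.eRk_mono (Set.subset_insert e S)
  exact lt_of_le_of_ne h1 (Ne.symm (he.2 S hS))

/-- **(♠′) FROM A RESERVOIR**: at the tight layer `#E = p + q`, if the reservoir has at least `p − q − 1` elements, the
rank-`q` supersets of members inject into the big middle sets by `S ↦ S ∪ W(p − #S)`, `W(j)` a fixed `j`-subset of the
reservoir. -/
theorem spadeInjection_of_reservoir (p q : ℕ) (hE : M.E.ncard = p + q)
    (hG : p - q - 1 ≤ (spadeReservoir M p q).ncard) : SpadeInjection M p q := by
  classical
  have hEfin : M.E.Finite := M.set_finite M.E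
  have hGfin : (spadeReservoir M p q).Finite := hEfin.subset (fun e he => he.1)
  have hW : ∀ j : ℕ, j ≤ (spadeReservoir M p q).ncard → ∃ W : Set α, W ⊆ spadeReservoir M p q ∧ W.ncard = j :=
    fun j hj => Set.exists_subset_card_eq hj
  choose! W hW using hW
  -- the size `p − #S` of the repair is at most `p − q − 1`
  have hj : ∀ S ∈ rankqOver M p q, p - S.ncard ≤ (spadeReservoir M p q).ncard := by
    intro S hS
    have := hS.2.2.1
    omega
  refine ⟨fun S => S ∪ W (p - S.ncard), ?_, ?_⟩
  · -- injectivity: a set of ℛ inside `S ∪ W` avoids `W`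
    have key : ∀ S₁ ∈ rankqOver M p q, ∀ S₂ ∈ rankqOver M p q,
        S₁ ∪ W (p - S₁.ncard) = S₂ ∪ W (p - S₂.ncard) → S₂ ⊆ S₁ := by
      intro S₁ hS₁ S₂ hS₂ hEq x hx
      have hx' : x ∈ S₁ ∪ W (p - S₁.ncard) := by
        rw [hEq]
        exact Or.inl hx
      rcases hx' with hx1 | hxW
      · exact hx1
      · exact absurd ((hW _ (hj S₁ hS₁)).1 hxW) (notMem_spadeReservoir_of_mem M hS₂ hx)
    intro S₁ hS₁ S₂ hS₂ hEq
    simp only at hEq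
    exact Set.Subset.antisymm (key S₂ hS₂ S₁ hS₁ hEq.symm) (key S₁ hS₁ S₂ hS₂ hEq)
  · intro S hS
    obtain ⟨hSE, hrS, hlo, hhi, -⟩ := id hS
    obtain ⟨hWG, hWcard⟩ := hW _ (hj S hS)
    have hSfin : S.Finite := hEfin.subset hSE
    have hWfin : (W (p - S.ncard)).Finite := hGfin.subset hWG
    have hWE : W (p - S.ncard) ⊆ M.E := hWG.trans (fun e he => he.1)
    have hdisj : Disjoint S (W (p - S.ncard)) := by
      rw [Set.disjoint_left]
      intro x hxS hxW
      exact notMem_spadeReservoir_of_mem M hS hxS (hWG hxW)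
    have hTcard : (S ∪ W (p - S.ncard)).ncard = p := by
      rw [Set.ncard_union_eq hdisj hSfin hWfin, hWcard]
      omega
    -- the reservoir part is nonempty
    have hWne : (W (p - S.ncard)).Nonempty := by
      rw [← Set.ncard_pos hWfin, hWcard]
      omega
    obtain ⟨w, hw⟩ := hWne
    refine ⟨⟨union_subset hSE hWE, ?_, ?_, ?_⟩, subset_union_left⟩
    · -- rank above `q`: through `insert w S`
      calc (q : ℕ∞) < M.eRk (insert w S) := lt_eRk_insert_of_mem_spadeReservoir M hS (hWG hw)
        _ ≤ M.eRk (S ∪ W (p - S.ncard)) := by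
          apply M.eRk_mono
          intro x hx
          rcases hx with rfl | hxS
          · exact Or.inr hw
          · exact Or.inl hxS
    · -- rank below `p`: submodularity and `#W = p − #S ≤ p − q − 1`
      calc M.eRk (S ∪ W (p - S.ncard)) ≤ M.eRk S + M.eRk (W (p - S.ncard)) := M.eRk_union_le_eRk_add_eRk _ _
        _ ≤ M.eRk S + (W (p - S.ncard)).encard := add_le_add_right (M.eRk_le_encard _) _
        _ = ((q + (p - S.ncard) : ℕ) : ℕ∞) := by
          rw [hrS, ← hWfin.cast_ncard_eq, hWcard]
          push_cast
          rfl
        _ < (p : ℕ∞) := by exact_mod_cast (show q + (p - S.ncard) < p by omega)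
    · rw [hTcard]

/-- **C-044, UP FORM, AT THE TIGHT LAYER FROM A RESERVOIR**: `#E = p + q` and `p − q − 1 ≤ #(reservoir)` ⇒ every family `𝒜`
of members has at least `Φ(p,q)·#𝒜` UP-neighbours. -/
theorem hallUp_of_ncard_eq_of_reservoir (p q : ℕ) (hE : M.E.ncard = p + q)
    (hG : p - q - 1 ≤ (spadeReservoir M p q).ncard) (𝒜 : Set (Set α)) (h𝒜 : 𝒜 ⊆ cellMembers M p q) :
    phiK p q * (𝒜.ncard : ℚ) ≤ ((upNbhd M p q 𝒜).ncard : ℚ) :=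
  hallUp_of_ncard_eq_of_spade M p q hE (spadeInjection_of_reservoir M p q hE hG) 𝒜 h𝒜

omit [M.Finite] in
/-- When ℛ is empty the reservoir is all of `E`. -/
theorem spadeReservoir_eq_of_rankqOver_empty {p q : ℕ} (h : rankqOver M p q = ∅) : spadeReservoir M p q = M.E := by
  ext e
  constructor
  · exact fun he => he.1
  · intro he
    refine ⟨he, fun S hS => ?_⟩
    rw [h] at hS
    exact absurd hS (Set.notMem_empty S)

/-- **C-044, UP FORM, AT THE TIGHT LAYER WHEN ℛ IS EMPTY** (no rank-`q` set with more than `q` elements contains a member):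
the upward Boolean LYM count alone gives the UP-Hall condition for every family of members (`#E = p + q`, `q + 1 ≤ p`). -/
theorem hallUp_of_ncard_eq_of_rankqOver_empty (p q : ℕ) (hE : M.E.ncard = p + q) (hqp : q + 1 ≤ p)
    (h : rankqOver M p q = ∅) (𝒜 : Set (Set α)) (h𝒜 : 𝒜 ⊆ cellMembers M p q) :
    phiK p q * (𝒜.ncard : ℚ) ≤ ((upNbhd M p q 𝒜).ncard : ℚ) := by
  refine hallUp_of_ncard_eq_of_reservoir M p q hE ?_ 𝒜 h𝒜
  rw [spadeReservoir_eq_of_rankqOver_empty M h, hE]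
  omega

end PercRepro
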